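/-
Copyright (c) 2026. All rights reserved.
Released under Apache 2.0 license as described in the file LICENSE.
Authors: abc-iut cell, seat abc-iut-L6-t6 (capstone of RULING C5‴: the birationalization of a Frobenioid).
-/
import Literature.AlgebraicGeometry.Frobenioids.BirationalizationBiratData
import Literature.AlgebraicGeometry.Frobenioids.BiratLocalization
import HarnessLib

/-!
# Frobenioids I, Proposition 4.4 (i), (ii): unconditional for a Frobenioid

Mochizuki, *The geometry of Frobenioids I: the general theory*, Kyushu J. Math. **62** (2008),
Proposition 4.4 (i), (ii), kurims pp. 82–84 [cite: MochizukiFrdI2008, Prop. 4.4 p.82]. The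
birationalization `C → C^birat` of abc-iut-L6-t8 (`Birat F hF hsq`, `toBirat`) and the `BiratData`
instance `biratData hF hsq` of `BirationalizationBiratData.lean` are built under the auxiliary
hypothesis `hsq : HasBiratSquares F` (existence of the composition squares of Prop. 4.4 (i), i.e.
Prop. 1.11 (vii)); `BiratLocalization.lean` proves `hasBiratSquares_of_isFrobenioid : IsFrobenioid F →
HasBiratSquares F`. This proof-only capstone records the resulting UNCONDITIONAL forms for a Frobenioid:
[FrdI] Prop. 4.4 (i), (ii) as typed by abc-iut-L1-t3 (`PreFrobenioidData.Prop44i`, `Prop44ii`) for the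
birationalization datum `biratData hF (hasBiratSquares_of_isFrobenioid hF)` (`prop44i_holds_of_isFrobenioid`,
`prop44ii_holds_of_isFrobenioid`), and the localization description of `C^birat` (Prop. 4.4 (i)/(iv),
"inductive limit") without the auxiliary hypothesis. No new notion; nothing here bears on the disputed
IUT claims.
-/

namespace Literature.AlgebraicGeometry.Frobenioids

open CategoryTheory Opposite

namespace PreFrobenioid

universe w v v' u u'

variable {D : Type u} [Category.{v} D] {Φ : Dᵒᵖ ⥤ CommMonCat.{w}}
  {C : Type u'} [Category.{v'} C] {F : C ⥤ ElemFrobenioid Φ} (hF : IsFrobenioid F)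

/-- **[FrdI] Prop. 4.4 (i) HOLDS for every Frobenioid** (abc-iut-L1-t3's `Prop44i` at the birationalization
datum: `C → C^birat` lies over `D` and preserves Frobenius degrees). [cite: MochizukiFrdI2008, Prop. 4.4 (i) p.82] -/
theorem prop44i_holds_of_isFrobenioid : PreFrobenioidData.Prop44i (biratData hF (hasBiratSquares_of_isFrobenioid hF)) :=
  prop44i_biratData

/-- **[FrdI] Prop. 4.4 (ii) HOLDS for every Frobenioid** (abc-iut-L1-t3's `Prop44ii` at the
birationalization datum: group-like type, `C → C^birat` faithful, units detected in `C^birat`).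
[cite: MochizukiFrdI2008, Prop. 4.4 (ii) p.83] -/
theorem prop44ii_holds_of_isFrobenioid : PreFrobenioidData.Prop44ii (biratData hF (hasBiratSquares_of_isFrobenioid hF)) :=
  prop44ii_biratData

/-- Prop. 4.4 (i)/(iv), hypothesis-free: `C → C^birat` is a localization of `C` at the co-angular
pre-steps (Mathlib `Functor.IsLocalization`). [cite: MochizukiFrdI2008, Prop. 4.4 (i) p.82] -/
theorem isLocalization_of_isFrobenioid :
    (toBirat F hF (hasBiratSquares_of_isFrobenioid hF)).IsLocalization (coAngularPreSteps F) :=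
  toBirat_isLocalization hF _

end PreFrobenioid

end Literature.AlgebraicGeometry.Frobenioids
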